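import Mathlib
import Literature.Analysis.OperatorTheory.GramLaplaceNormLogConvex
import Summits.NavierStokesRegularity.FluidComputer.MonotoneSchurStep

/-!
# Skew-cut certificate, RELAXED route: the enclosure chain from a float inverse proposal to (I1)–(I2)
(instab3 g2 = implementation 1 of SPEC-P-TOWER-2 ⟦I-X0⟧, cell `ns-blowup`, 2026-08-26)

HONEST FRAMING (human ruling D-0035): nothing here is a claim about Navier–Stokes blow-up.
WHAT THIS IS NOT: not NS evidence. This is the finite-dimensional linear algebra behind the
RELAXED verdict `(V5r)` of the instab3 certifier `HOME/instab3/code/i3cert.py` (method note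
`HOME/instab3/INSTAB3-METHOD.md` §5), which certifies the hypotheses (I1) `h_K = λ_min ½(P_K + P_Kᵀ) > 0`
and (I2) `m_t − θ_K² > 0`, `θ_K² = ¼ λ_max(Wᵀ H_K⁻¹ W)`, of THEOREM 1 of `selfsim/SKEWCUT-CERT.md`
(kernel lemmas `SkewCutCertificate.lean`, `SkewCutAPosteriori.lean`) for the MODEL operator «NS
linearised about the forced ABC flow», class II, at `(x, K)` = (0.2985/0.3185, 41) for `R = 800`
and (0.3053/0.3253, 43) for `R = 1000` (kit j250421 / j250422). The SHARP verdict of the same runs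
rests on the v3 lemmas alone; this file makes the relaxed verdict kernel-backed as well.

What the certifier holds is NOT the pivot `P_K` but the shell-`K` block `N = N_K` of the inverse of
the section (as a ball matrix) and a FLOAT proposal `P̂` for `N⁻¹`, with a certified spectral-norm
residual `‖1 − N P̂‖ ≤ η < 1`. The chain, all in the `ℓ²`-operator (spectral) norm
(`Matrix.Norms.L2Operator`) on real matrices:

* (R0) `isUnit_det_of_l2_opNorm_one_sub_mul_lt` — `‖1 − N P̂‖ < 1` ⇒ `N` nonsingular (a kernel
  vector `v` of `N P̂ = 1 − F` would give `vᵀv = vᵀFv ≤ ‖F‖ vᵀv < vᵀv`).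
* (R1) `Units.norm_inv_sub_le_of_norm_one_sub_mul_right_lt` — Neumann/a-posteriori enclosure with the
  residual on the RIGHT, in any normed ring: `‖1 − a r‖ = θ < 1` ⇒ `‖a⁻¹ − r‖ ≤ ‖r‖ θ/(1 − θ)`
  (companion of `APosterioriInverseBound.Units.norm_inv_sub_le`, residual on the left); so
  `‖P_K − P̂‖ ≤ δ := ‖P̂‖ η/(1 − η)`.
* (R2) `dotProduct_mulVec_add_transpose_ge` — WEYL in quadratic-form language:
  `‖P − P̂‖ ≤ δ` ⇒ `vᵀ(P + Pᵀ)v ≥ vᵀ(P̂ + P̂ᵀ)v − 2δ vᵀv`, i.e. `2H_K ≽ Ŝ − 2δ·1`, `Ŝ := P̂ + P̂ᵀ`.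
* (R3) LOEWNER antitonicity of the inverse is `MonotoneSchurStep.dotProduct_inv_mulVec_le`
  (`0 ≺ L ≼ S` ⇒ `cᵀS⁻¹c ≤ cᵀL⁻¹c`), and congruence by `W` is monotone; hence
  `θ_K² = ½ sup_v vᵀWᵀ(P + Pᵀ)⁻¹Wv / vᵀv ≤ ½ λ_max(Wᵀ(Ŝ − 2δ)⁻¹W)`.
* `relaxed_hypotheses_of_enclosure` — the assembled statement exactly as the certificate uses it:
  from `‖1 − N P̂‖ ≤ η < 1`, `‖P̂‖η/(1 − η) ≤ δ`, `Ŝ − (2δ + τ)·1 ≽ 0` with `τ > 0` (the certifier's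
  congruence–Gershgorin test «`λ_min(sym P̂) > t`», `τ = 2(t − δ) = 2h̲`) and `σ·1 − Wᵀ(Ŝ − 2δ·1)⁻¹W ≽ 0`
  (its certified upper bound `σ = 4θ̄²`), conclude: `N` nonsingular, `S := N⁻¹ + N⁻¹ᵀ = 2H_K` is
  positive definite with `S − τ·1 ≽ 0` — (I1) with `h_K ≥ τ/2 = h̲` —, and
  `(Wv)ᵀ S⁻¹ (Wv) ≤ σ vᵀv` for all `v` — so `θ_K² = ¼·sup (Wv)ᵀH_K⁻¹(Wv)/vᵀv = ½·sup (Wv)ᵀS⁻¹(Wv)/vᵀv ≤ σ/2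
  = 2θ̄²`… precisely: `H_K⁻¹ = 2S⁻¹`, so `¼(Wv)ᵀH_K⁻¹(Wv) = ½(Wv)ᵀS⁻¹(Wv) ≤ (σ/2) vᵀv`, and the
  certificate's RELAXED verdict `m_t − σ/2 > 0` is (I2).

How the float/ball layer discharges the four hypotheses (IEEE a-priori `γ_n` bounds for the
product `N P̂`, Frobenius ≥ spectral norm, congruence–Gershgorin in Arb balls) is numerical
analysis recorded in INSTAB3-METHOD §5 and is not formalised here. Mathlib + two tree files; no
new definitions. MODEL lane; bears_on LADDER-NS N1* (numerical-witness inputs ⟦I-X0⟧); METER 0.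
-/

namespace Summit.NavierStokesRegularity.FluidComputer.SkewCutRelaxedEnclosure

/-! ## (R1) Right-residual a-posteriori inverse enclosure in any normed ring -/

section NormedRing

variable {A : Type*} [NormedRing A]

/-- **A-posteriori bound on the inverse, residual on the right.** For a unit `a` and any `r` with
`θ := ‖1 − a·r‖ < 1`: `‖a⁻¹‖ ≤ ‖r‖/(1 − θ)` — from `a⁻¹ − r = a⁻¹(1 − a r)`. -/
theorem Units.norm_inv_le_of_norm_one_sub_mul_right_lt (a : Aˣ) (r : A) (hθ : ‖1 - a * r‖ < 1) :
    ‖(↑a⁻¹ : A)‖ ≤ ‖r‖ / (1 - ‖1 - a * r‖) := by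
  set θ := ‖1 - (a : A) * r‖ with hθdef
  have key : (↑a⁻¹ : A) - r = ↑a⁻¹ * (1 - a * r) := by
    rw [mul_sub, mul_one, ← mul_assoc, Units.inv_mul, one_mul]
  have h1 : ‖(↑a⁻¹ : A) - r‖ ≤ ‖(↑a⁻¹ : A)‖ * θ := by
    rw [key]; exact norm_mul_le _ _
  have h2 : ‖(↑a⁻¹ : A)‖ ≤ ‖(↑a⁻¹ : A) - r‖ + ‖r‖ := by
    have := norm_add_le ((↑a⁻¹ : A) - r) r
    simpa using this
  have h1θ : 0 < 1 - θ := by linarith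
  rw [le_div_iff₀ h1θ]
  nlinarith [norm_nonneg ((↑a⁻¹ : A) - r), norm_nonneg r, norm_nonneg (↑a⁻¹ : A)]

/-- **A-posteriori bound on the inverse ERROR, residual on the right.** For a unit `a` and any `r`
with `θ := ‖1 − a·r‖ < 1`: `‖a⁻¹ − r‖ ≤ ‖r‖·θ/(1 − θ)`. In the relaxed certificate `a = N_K`
(shell-`K` block of the inverse of the section, known only as a ball matrix), `r = P̂` the float
inverse of its midpoint, and the bound is `δ = ‖P̂‖₂ η/(1 − η) ≥ ‖P_K − P̂‖₂`. -/
theorem Units.norm_inv_sub_le_of_norm_one_sub_mul_right_lt (a : Aˣ) (r : A)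
    (hθ : ‖1 - a * r‖ < 1) :
    ‖(↑a⁻¹ : A) - r‖ ≤ ‖r‖ * ‖1 - a * r‖ / (1 - ‖1 - a * r‖) := by
  set θ := ‖1 - (a : A) * r‖ with hθdef
  have key : (↑a⁻¹ : A) - r = ↑a⁻¹ * (1 - a * r) := by
    rw [mul_sub, mul_one, ← mul_assoc, Units.inv_mul, one_mul]
  have h1 : ‖(↑a⁻¹ : A) - r‖ ≤ ‖(↑a⁻¹ : A)‖ * θ := by
    rw [key]; exact norm_mul_le _ _
  have h2 := Units.norm_inv_le_of_norm_one_sub_mul_right_lt a r hθ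
  have hθ0 : 0 ≤ θ := norm_nonneg _
  have h1θ : 0 < 1 - θ := by linarith
  calc ‖(↑a⁻¹ : A) - r‖ ≤ ‖(↑a⁻¹ : A)‖ * θ := h1
    _ ≤ (‖r‖ / (1 - θ)) * θ := mul_le_mul_of_nonneg_right h2 hθ0
    _ = ‖r‖ * θ / (1 - θ) := by ring

/-- Monotonicity of the Neumann factor: `θ ≤ η < 1` ⇒ `c·θ/(1 − θ) ≤ c·η/(1 − η)` for `c ≥ 0`
(the certificate checks `η`, an UPPER bound of the residual norm `θ`). -/
theorem mul_div_one_sub_mono {c θ η : ℝ} (hc : 0 ≤ c) (hθη : θ ≤ η) (hη : η < 1) :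
    c * θ / (1 - θ) ≤ c * η / (1 - η) := by
  have h1 : 0 < 1 - θ := by linarith
  have h2 : 0 < 1 - η := by linarith
  rw [div_le_div_iff₀ h1 h2]
  nlinarith [mul_nonneg hc (sub_nonneg.mpr hθη)]

end NormedRing

/-! ## (R0), (R2), (R3) for real matrices in the spectral norm -/

section Spectral

open Matrix
open scoped Matrix.Norms.L2Operator
open Literature.Analysis.OperatorTheory (dotProduct_mulVec_le_l2_opNorm)

variable {m n : Type*} [Fintype m] [DecidableEq m] [Fintype n] [DecidableEq n]

omit [DecidableEq m] in
/-- `vᵀv > 0` for a nonzero real vector. -/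
theorem dotProduct_self_pos_of_ne_zero {v : m → ℝ} (hv : v ≠ 0) : 0 < v ⬝ᵥ v := by
  rcases lt_or_eq_of_le (dotProduct_star_self_nonneg v) with h | h
  · simpa using h
  · exact absurd (dotProduct_self_eq_zero.mp (by simpa using h.symm)) hv

/-- **(R0) Nonsingularity from a RIGHT residual in the spectral norm.** If `‖1 − N·R‖ < 1`
(`ℓ²`-operator norm, `R` ANY matrix — in practice a floating-point inverse) then `N` is
nonsingular: a kernel vector `v` of `N R = 1 − F` satisfies `vᵀv = vᵀFv ≤ ‖F‖·vᵀv < vᵀv`. -/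
theorem isUnit_det_of_l2_opNorm_one_sub_mul_lt (N R : Matrix m m ℝ) (h : ‖1 - N * R‖ < 1) :
    IsUnit N.det := by
  set F : Matrix m m ℝ := 1 - N * R with hF
  have hNR : N * R = 1 - F := by rw [hF, sub_sub_cancel]
  have hdet : (1 - F).det ≠ 0 := by
    intro hdet
    obtain ⟨v, hv, hFv⟩ := (Matrix.exists_mulVec_eq_zero_iff).mpr hdet
    have hv' : F *ᵥ v = v := by
      have : (1 - F) *ᵥ v = v - F *ᵥ v := by rw [Matrix.sub_mulVec, Matrix.one_mulVec]
      rw [this] at hFv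
      exact (sub_eq_zero.mp hFv).symm
    have hle : v ⬝ᵥ v ≤ ‖F‖ * (v ⬝ᵥ v) := by
      calc v ⬝ᵥ v = v ⬝ᵥ (F *ᵥ v) := by rw [hv']
        _ ≤ ‖F‖ * (v ⬝ᵥ v) := dotProduct_mulVec_le_l2_opNorm F v
    have hpos := dotProduct_self_pos_of_ne_zero hv
    nlinarith
  rw [← hNR, Matrix.det_mul] at hdet
  exact isUnit_iff_ne_zero.mpr (left_ne_zero_of_mul hdet)

/-- **(R1) for matrices: the enclosure of the true inverse by the float proposal.** If
`‖1 − N P̂‖ ≤ η < 1` and `‖P̂‖·η/(1 − η) ≤ δ` (spectral norm) then `N` is nonsingular and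
`‖N⁻¹ − P̂‖ ≤ δ`. -/
theorem l2_opNorm_inv_sub_le (N Ph : Matrix m m ℝ) {η δ : ℝ} (hres : ‖1 - N * Ph‖ ≤ η)
    (hη : η < 1) (hδ : ‖Ph‖ * η / (1 - η) ≤ δ) : ‖N⁻¹ - Ph‖ ≤ δ := by
  have hlt : ‖1 - N * Ph‖ < 1 := lt_of_le_of_lt hres hη
  have hN : IsUnit N.det := isUnit_det_of_l2_opNorm_one_sub_mul_lt N Ph hlt
  have hNu : IsUnit N := (Matrix.isUnit_iff_isUnit_det N).mpr hN
  obtain ⟨a, ha⟩ := hNu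
  have hinv : (↑a⁻¹ : Matrix m m ℝ) = N⁻¹ := by
    rw [← ha, Matrix.coe_units_inv]
  have hlt' : ‖1 - (a : Matrix m m ℝ) * Ph‖ < 1 := by rw [ha]; exact hlt
  have h1 := Units.norm_inv_sub_le_of_norm_one_sub_mul_right_lt a Ph hlt'
  rw [hinv, ha] at h1
  exact h1.trans ((mul_div_one_sub_mono (norm_nonneg Ph) hres hη).trans hδ)

omit [DecidableEq m] in
/-- The quadratic form of `Pᵀ` equals that of `P`. -/
theorem dotProduct_mulVec_transpose (P : Matrix m m ℝ) (v : m → ℝ) :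
    v ⬝ᵥ (Pᵀ *ᵥ v) = v ⬝ᵥ (P *ᵥ v) := by
  rw [Matrix.mulVec_transpose, dotProduct_comm, Matrix.dotProduct_mulVec]

omit [DecidableEq m] in
/-- The quadratic form of `P + Pᵀ` is twice that of `P`. -/
theorem dotProduct_mulVec_add_transpose (P : Matrix m m ℝ) (v : m → ℝ) :
    v ⬝ᵥ ((P + Pᵀ) *ᵥ v) = 2 * (v ⬝ᵥ (P *ᵥ v)) := by
  rw [Matrix.add_mulVec, dotProduct_add, dotProduct_mulVec_transpose]; ring

/-- **(R2) Weyl's inequality in quadratic-form language.** If `‖P − P̂‖ ≤ δ` (spectral norm) then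
`vᵀ(P + Pᵀ)v ≥ vᵀ(P̂ + P̂ᵀ)v − 2δ·vᵀv` for every `v`: the symmetric part of the (unknown) pivot is
bounded below, in the Loewner order, by the symmetric part of the float proposal shifted by `δ`. -/
theorem dotProduct_mulVec_add_transpose_ge (P Ph : Matrix m m ℝ) {δ : ℝ} (h : ‖P - Ph‖ ≤ δ)
    (v : m → ℝ) : v ⬝ᵥ ((Ph + Phᵀ) *ᵥ v) - 2 * δ * (v ⬝ᵥ v) ≤ v ⬝ᵥ ((P + Pᵀ) *ᵥ v) := by
  rw [dotProduct_mulVec_add_transpose, dotProduct_mulVec_add_transpose]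
  have h1 : v ⬝ᵥ ((Ph - P) *ᵥ v) ≤ ‖Ph - P‖ * (v ⬝ᵥ v) := dotProduct_mulVec_le_l2_opNorm _ v
  have h2 : ‖Ph - P‖ ≤ δ := by rw [norm_sub_rev]; exact h
  have h3 : 0 ≤ v ⬝ᵥ v := by simpa using dotProduct_star_self_nonneg v
  have h4 : v ⬝ᵥ ((Ph - P) *ᵥ v) = v ⬝ᵥ (Ph *ᵥ v) - v ⬝ᵥ (P *ᵥ v) := by
    rw [Matrix.sub_mulVec, dotProduct_sub]
  nlinarith [mul_le_mul_of_nonneg_right h2 h3]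

omit [Fintype m] [DecidableEq m] in
/-- `P + Pᵀ` is symmetric (Hermitian over `ℝ`). -/
theorem isHermitian_add_transpose (P : Matrix m m ℝ) : (P + Pᵀ).IsHermitian := by
  rw [Matrix.IsHermitian, Matrix.conjTranspose_eq_transpose_of_trivial, Matrix.transpose_add,
    Matrix.transpose_transpose, add_comm]

omit [Fintype m] in
/-- A real scalar matrix is Hermitian. -/
theorem isHermitian_smul_one (c : ℝ) : (c • (1 : Matrix m m ℝ)).IsHermitian := by
  rw [Matrix.IsHermitian, Matrix.conjTranspose_smul, Matrix.conjTranspose_one, star_trivial]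

/-- Quadratic form of a shifted matrix: `vᵀ(M − c·1)v = vᵀMv − c·vᵀv`. -/
theorem dotProduct_mulVec_sub_smul_one (M : Matrix m m ℝ) (c : ℝ) (v : m → ℝ) :
    v ⬝ᵥ ((M - c • (1 : Matrix m m ℝ)) *ᵥ v) = v ⬝ᵥ (M *ᵥ v) - c * (v ⬝ᵥ v) := by
  rw [Matrix.sub_mulVec, dotProduct_sub, Matrix.smul_mulVec, Matrix.one_mulVec,
    dotProduct_smul, smul_eq_mul]

/-- **(I1) from the enclosure.** If `‖P − P̂‖ ≤ δ` and the float test certifies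
`(P̂ + P̂ᵀ) − (2δ + τ)·1 ≽ 0` with `τ > 0`, then `S := P + Pᵀ` (twice the symmetric part `H` of
the true pivot) is positive definite and `S − τ·1 ≽ 0`, i.e. `h = λ_min(H) ≥ τ/2 > 0`. -/
theorem posDef_add_transpose_of_enclosure (P Ph : Matrix m m ℝ) {δ τ : ℝ} (h : ‖P - Ph‖ ≤ δ)
    (hτ : 0 < τ) (ht : ((Ph + Phᵀ) - (2 * δ + τ) • (1 : Matrix m m ℝ)).PosSemidef) :
    (P + Pᵀ).PosDef ∧ ((P + Pᵀ) - τ • (1 : Matrix m m ℝ)).PosSemidef := by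
  have key : ∀ v : m → ℝ, τ * (v ⬝ᵥ v) ≤ v ⬝ᵥ ((P + Pᵀ) *ᵥ v) := by
    intro v
    have h1 := dotProduct_mulVec_add_transpose_ge P Ph h v
    have h2 : 0 ≤ v ⬝ᵥ (((Ph + Phᵀ) - (2 * δ + τ) • (1 : Matrix m m ℝ)) *ᵥ v) := by
      simpa using ht.dotProduct_mulVec_nonneg v
    rw [dotProduct_mulVec_sub_smul_one] at h2
    linarith
  refine ⟨PosDef.of_dotProduct_mulVec_pos (isHermitian_add_transpose P) fun v hv => ?_,
    PosSemidef.of_dotProduct_mulVec_nonneg ((isHermitian_add_transpose P).sub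
      (isHermitian_smul_one τ)) fun v => ?_⟩
  · have hvv := dotProduct_self_pos_of_ne_zero hv
    have := key v
    simp only [star_trivial]
    nlinarith
  · simp only [star_trivial]
    rw [dotProduct_mulVec_sub_smul_one]
    linarith [key v]

/-- **(R3) + congruence: (I2) from the enclosure.** With `S := P + Pᵀ`, `S̲ := (P̂ + P̂ᵀ) − 2δ·1`:
if `‖P − P̂‖ ≤ δ`, `S̲ − τ·1 ≽ 0` with `τ > 0`, and the float test certifies
`σ·1 − Wᵀ S̲⁻¹ W ≽ 0`, then `(Wv)ᵀ S⁻¹ (Wv) ≤ σ·vᵀv` for every `v` — Loewner antitonicity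
`S̲ ≼ S ⇒ S⁻¹ ≼ S̲⁻¹` (`MonotoneSchurStep.dotProduct_inv_mulVec_le`) composed with the congruence
by `W`. Since `H⁻¹ = 2S⁻¹` for `H = ½S`, this reads `¼(Wv)ᵀH⁻¹(Wv) ≤ (σ/2)·vᵀv`, i.e.
`θ² ≤ σ/2`. -/
theorem congr_inv_le_of_enclosure (P Ph : Matrix m m ℝ) (W : Matrix m n ℝ) {δ τ σ : ℝ}
    (h : ‖P - Ph‖ ≤ δ) (hτ : 0 < τ)
    (ht : ((Ph + Phᵀ) - (2 * δ + τ) • (1 : Matrix m m ℝ)).PosSemidef)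
    (hW : (σ • (1 : Matrix n n ℝ) -
      Wᵀ * ((Ph + Phᵀ) - (2 * δ) • (1 : Matrix m m ℝ))⁻¹ * W).PosSemidef) (v : n → ℝ) :
    (W *ᵥ v) ⬝ᵥ ((P + Pᵀ)⁻¹ *ᵥ (W *ᵥ v)) ≤ σ * (v ⬝ᵥ v) := by
  set L : Matrix m m ℝ := (Ph + Phᵀ) - (2 * δ) • (1 : Matrix m m ℝ) with hL
  have hLherm : L.IsHermitian := (isHermitian_add_transpose Ph).sub (isHermitian_smul_one _)
  -- `L` is positive definite: `vᵀLv ≥ τ vᵀv`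
  have hLform : ∀ w : m → ℝ, τ * (w ⬝ᵥ w) ≤ w ⬝ᵥ (L *ᵥ w) := by
    intro w
    have h2 : 0 ≤ w ⬝ᵥ (((Ph + Phᵀ) - (2 * δ + τ) • (1 : Matrix m m ℝ)) *ᵥ w) := by
      simpa using ht.dotProduct_mulVec_nonneg w
    rw [dotProduct_mulVec_sub_smul_one] at h2
    rw [hL, dotProduct_mulVec_sub_smul_one]
    linarith
  have hLpd : L.PosDef := by
    refine PosDef.of_dotProduct_mulVec_pos hLherm fun w hw => ?_
    have hww := dotProduct_self_pos_of_ne_zero hw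
    simp only [star_trivial]
    nlinarith [hLform w]
  -- `S − L ≽ 0` by Weyl
  have hSL : ((P + Pᵀ) - L).PosSemidef := by
    refine PosSemidef.of_dotProduct_mulVec_nonneg ((isHermitian_add_transpose P).sub hLherm)
      fun w => ?_
    simp only [star_trivial]
    rw [Matrix.sub_mulVec, dotProduct_sub, hL, dotProduct_mulVec_sub_smul_one]
    linarith [dotProduct_mulVec_add_transpose_ge P Ph h w]
  -- Loewner antitonicity of the inverse, then the certified congruence bound
  have h1 := MonotoneSchurStep.dotProduct_inv_mulVec_le hLpd hSL (W *ᵥ v)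
  simp only [star_trivial] at h1
  have h2 : 0 ≤ v ⬝ᵥ ((σ • (1 : Matrix n n ℝ) - Wᵀ * L⁻¹ * W) *ᵥ v) := by
    simpa using hW.dotProduct_mulVec_nonneg v
  have h3 : v ⬝ᵥ ((σ • (1 : Matrix n n ℝ) - Wᵀ * L⁻¹ * W) *ᵥ v)
      = σ * (v ⬝ᵥ v) - (W *ᵥ v) ⬝ᵥ (L⁻¹ *ᵥ (W *ᵥ v)) := by
    rw [Matrix.sub_mulVec, dotProduct_sub, Matrix.smul_mulVec, Matrix.one_mulVec,
      dotProduct_smul, smul_eq_mul, ← Matrix.mulVec_mulVec, ← Matrix.mulVec_mulVec,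
      Matrix.dotProduct_mulVec, Matrix.vecMul_transpose]
  rw [h3] at h2
  linarith

/-- **The relaxed certificate, assembled (INSTAB3-METHOD §5 (V5r)).** Data: `N` (the shell-`K`
block `N_K` of the inverse of the `K`-section `A⁽ᴷ⁾(x)` — so `N⁻¹ = P_K`, the boundary Schur
complement, and `½(N⁻¹ + N⁻¹ᵀ) = H_K`), a float matrix `P̂`, the stretching block `W = W_K`, and
reals `η δ τ σ` with the four CERTIFIED inequalities
`‖1 − N P̂‖₂ ≤ η < 1`, `‖P̂‖₂ η/(1 − η) ≤ δ`, `(P̂ + P̂ᵀ) − (2δ + τ)·1 ≽ 0` (`τ > 0`),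
`σ·1 − Wᵀ((P̂ + P̂ᵀ) − 2δ·1)⁻¹W ≽ 0`. Conclusions: `N` is nonsingular; `S := N⁻¹ + N⁻¹ᵀ ≻ 0`
with `S − τ·1 ≽ 0` — (I1) with `h_K ≥ τ/2` —; and `(Wv)ᵀS⁻¹(Wv) ≤ σ vᵀv` for all `v` — so
`θ_K² = ¼ sup (Wv)ᵀH_K⁻¹(Wv)/vᵀv ≤ σ/2`, and the printed RELAXED verdict `m_t − σ/2 > 0` is (I2).
In the certifier's symbols: `η` = `eta`, `δ` = `delta_P`, `τ = 2·h_lo`, `σ = 4·theta2_hi`. -/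
theorem relaxed_hypotheses_of_enclosure (N Ph : Matrix m m ℝ) (W : Matrix m n ℝ)
    {η δ τ σ : ℝ} (hres : ‖1 - N * Ph‖ ≤ η) (hη : η < 1) (hδ : ‖Ph‖ * η / (1 - η) ≤ δ)
    (hτ : 0 < τ) (ht : ((Ph + Phᵀ) - (2 * δ + τ) • (1 : Matrix m m ℝ)).PosSemidef)
    (hW : (σ • (1 : Matrix n n ℝ) -
      Wᵀ * ((Ph + Phᵀ) - (2 * δ) • (1 : Matrix m m ℝ))⁻¹ * W).PosSemidef) :
    IsUnit N.det ∧ (N⁻¹ + N⁻¹ᵀ).PosDef ∧ ((N⁻¹ + N⁻¹ᵀ) - τ • (1 : Matrix m m ℝ)).PosSemidef ∧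
      ∀ v : n → ℝ, (W *ᵥ v) ⬝ᵥ ((N⁻¹ + N⁻¹ᵀ)⁻¹ *ᵥ (W *ᵥ v)) ≤ σ * (v ⬝ᵥ v) := by
  have hN : IsUnit N.det :=
    isUnit_det_of_l2_opNorm_one_sub_mul_lt N Ph (lt_of_le_of_lt hres hη)
  have henc : ‖N⁻¹ - Ph‖ ≤ δ := l2_opNorm_inv_sub_le N Ph hres hη hδ
  obtain ⟨h1, h2⟩ := posDef_add_transpose_of_enclosure N⁻¹ Ph henc hτ ht
  exact ⟨hN, h1, h2, fun v => congr_inv_le_of_enclosure N⁻¹ Ph W henc hτ ht hW v⟩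

end Spectral

/-! ## Norm plumbing of the certificate's inputs (appended 2026-08-26, instab3 g2)

How the certifier produces the spectral-norm numbers consumed above: `η` is obtained from a
FROBENIUS norm (`‖1 − mid(N)P̂‖_F` plus an entrywise-radius term), and `‖P̂‖₂ ≤ c` from a
congruence–Gershgorin certificate `c²·1 − P̂ᵀP̂ ≻ 0` (`CongruenceDominancePosDef.lean`). The two
facts that make these valid inputs, for real matrices in the `ℓ²`-operator norm: -/

section Plumbing

open Matrix
open scoped Matrix.Norms.L2Operator
open Literature.Analysis.OperatorTheory (norm_toEuclideanCLM_sq_eq_dotProduct)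

variable {m : Type*} [Fintype m] [DecidableEq m]

/-- **Spectral norm ≤ Frobenius norm (real square matrices):** `‖A‖₂ ≤ (Σᵢⱼ a_ij²)^{1/2}`
(row-wise Cauchy–Schwarz; the real twin of `Literature…SpectralVariation.l2_opNorm_le_sqrt_sum_sq`).
This is how a float/ball Frobenius evaluation bounds the residual norm `‖1 − N P̂‖₂ ≤ η`; an
entrywise radius `|E_ij| ≤ r` contributes at most `(#m)·r` by the same inequality. -/
theorem l2_opNorm_le_sqrt_sum_sq (A : Matrix m m ℝ) : ‖A‖ ≤ √(∑ i, ∑ j, A i j ^ 2) := by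
  rw [← Matrix.l2_opNorm_toEuclideanCLM]
  refine ContinuousLinearMap.opNorm_le_bound _ (Real.sqrt_nonneg _) fun x => ?_
  have hF : 0 ≤ ∑ i, ∑ j, A i j ^ 2 := by positivity
  have hsq : ‖toEuclideanCLM (n := m) (𝕜 := ℝ) A x‖ ^ 2 ≤ (√(∑ i, ∑ j, A i j ^ 2) * ‖x‖) ^ 2 := by
    rw [EuclideanSpace.real_norm_sq_eq, mul_pow, Real.sq_sqrt hF, EuclideanSpace.real_norm_sq_eq,
      Finset.sum_mul]
    refine Finset.sum_le_sum fun i _ => ?_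
    have hi : toEuclideanCLM (n := m) (𝕜 := ℝ) A x i = ∑ j, A i j * x j := by
      rw [congrFun (Matrix.ofLp_toEuclideanCLM A x) i]; rfl
    rw [hi]
    exact Finset.sum_mul_sq_le_sq_mul_sq _ _ _
  exact (pow_le_pow_iff_left₀ (norm_nonneg _) (by positivity) two_ne_zero).mp hsq

/-- **Spectral norm from a Gram-form bound:** if `vᵀ(PᵀP)v ≤ c²·vᵀv` for all `v` (`c ≥ 0`) — e.g.
from a certified `c²·1 − PᵀP ≻ 0` — then `‖P‖₂ ≤ c` (since `‖Pv‖² = vᵀPᵀPv`). This is the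
certificate's `P2norm_hi`. -/
theorem l2_opNorm_le_of_gram_bound (P : Matrix m m ℝ) {c : ℝ} (hc : 0 ≤ c)
    (h : ∀ v : m → ℝ, v ⬝ᵥ ((Pᵀ * P) *ᵥ v) ≤ c ^ 2 * (v ⬝ᵥ v)) : ‖P‖ ≤ c := by
  rw [← Matrix.l2_opNorm_toEuclideanCLM]
  refine ContinuousLinearMap.opNorm_le_bound _ hc fun x => ?_
  have hsq : ‖toEuclideanCLM (n := m) (𝕜 := ℝ) P x‖ ^ 2 ≤ (c * ‖x‖) ^ 2 := by
    rw [norm_toEuclideanCLM_sq_eq_dotProduct, mul_pow, EuclideanSpace.real_norm_sq_eq]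
    have hxx : WithLp.ofLp x ⬝ᵥ WithLp.ofLp x = ∑ i, x i ^ 2 := by
      simp only [dotProduct, pow_two]
    have := h (WithLp.ofLp x)
    rw [hxx] at this
    exact this
  nlinarith [norm_nonneg (toEuclideanCLM (n := m) (𝕜 := ℝ) P x), norm_nonneg x,
    mul_nonneg hc (norm_nonneg x)]

end Plumbing

/-! ## Lemma 3.1 at the matrix level and the cross-term bound the certificate delivers (instab3 g2)
`SkewCutCertificate.re_inner_sub_ge` is SKEWCUT-CERT Lemma 3.1 in inner-product-space form; here is
the same completing-the-square for real matrices (`S = P + Pᵀ = 2H`, `N = P⁻¹`), composed with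
`relaxed_hypotheses_of_enclosure`: the certified `τ, σ` give EXACTLY the input of STEP 2 of the proof
of Theorem 1, `Re⟨N_K a, a⟩ − Re⟨N_K a, W_K v⟩ ≥ −θ_K²‖v‖²`, with `θ_K² ≤ σ/2`. -/

section CrossTerm
open Matrix
open scoped Matrix.Norms.L2Operator
variable {m n : Type*} [Fintype m] [DecidableEq m] [Fintype n] [DecidableEq n]

/-- **Lemma 3.1 (matrix form).** For a real square `P` with `S := P + Pᵀ ≻ 0` and every `w, c`:
`wᵀ P w − wᵀ c ≥ −½ cᵀ S⁻¹ c` (from `0 ≤ (w − w₀)ᵀ S (w − w₀)`, `w₀ = S⁻¹ c`, `wᵀPw = ½wᵀSw`). -/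
theorem dotProduct_mulVec_sub_dotProduct_ge (P : Matrix m m ℝ) (hS : (P + Pᵀ).PosDef)
    (w c : m → ℝ) :
    -(1 / 2) * (c ⬝ᵥ ((P + Pᵀ)⁻¹ *ᵥ c)) ≤ w ⬝ᵥ (P *ᵥ w) - w ⬝ᵥ c := by
  set S : Matrix m m ℝ := P + Pᵀ with hSdef
  have hSu : IsUnit S.det := (Matrix.isUnit_iff_isUnit_det _).mp hS.isUnit
  set w₀ : m → ℝ := S⁻¹ *ᵥ c with hw₀
  have hSw₀ : S *ᵥ w₀ = c := by rw [hw₀, mulVec_mulVec, mul_nonsing_inv _ hSu, one_mulVec]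
  have hsymm : Sᵀ = S := by rw [hSdef, transpose_add, transpose_transpose, add_comm]
  have h0 : 0 ≤ (w - w₀) ⬝ᵥ (S *ᵥ (w - w₀)) := by
    simpa using hS.posSemidef.dotProduct_mulVec_nonneg (w - w₀)
  have e1 : (w - w₀) ⬝ᵥ (S *ᵥ (w - w₀))
      = w ⬝ᵥ (S *ᵥ w) - w ⬝ᵥ (S *ᵥ w₀) - w₀ ⬝ᵥ (S *ᵥ w) + w₀ ⬝ᵥ (S *ᵥ w₀) := by
    rw [mulVec_sub, sub_dotProduct, dotProduct_sub, dotProduct_sub]; ring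
  have e2 : w₀ ⬝ᵥ (S *ᵥ w) = w ⬝ᵥ (S *ᵥ w₀) := by
    rw [dotProduct_mulVec, ← vecMul_transpose, hsymm, dotProduct_comm]
  have e3 : w ⬝ᵥ (S *ᵥ w) = 2 * (w ⬝ᵥ (P *ᵥ w)) := by
    rw [hSdef]; exact dotProduct_mulVec_add_transpose P w
  rw [e1, e2, hSw₀, e3, dotProduct_comm w₀ c] at h0
  linarith

/-- **The cross-term input of Theorem 1, STEP 2, from the certificate.** Under the four certified
inequalities of `relaxed_hypotheses_of_enclosure`, for every `a` (shell `K`) and `v` (shell `K+1`):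
`(N a)ᵀ a − (N a)ᵀ (W v) ≥ −(σ/2)·vᵀv` (Lemma 3.1 with `w = N a`, `P = N⁻¹`, then the `σ` bound). -/
theorem cross_term_ge_of_enclosure (N Ph : Matrix m m ℝ) (W : Matrix m n ℝ) {η δ τ σ : ℝ}
    (hres : ‖1 - N * Ph‖ ≤ η) (hη : η < 1) (hδ : ‖Ph‖ * η / (1 - η) ≤ δ) (hτ : 0 < τ)
    (ht : ((Ph + Phᵀ) - (2 * δ + τ) • (1 : Matrix m m ℝ)).PosSemidef)
    (hW : (σ • (1 : Matrix n n ℝ) -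
      Wᵀ * ((Ph + Phᵀ) - (2 * δ) • (1 : Matrix m m ℝ))⁻¹ * W).PosSemidef)
    (a : m → ℝ) (v : n → ℝ) :
    -(σ / 2) * (v ⬝ᵥ v) ≤ (N *ᵥ a) ⬝ᵥ a - (N *ᵥ a) ⬝ᵥ (W *ᵥ v) := by
  obtain ⟨hN, hS, -, hθ⟩ := relaxed_hypotheses_of_enclosure N Ph W hres hη hδ hτ ht hW
  have hPw : N⁻¹ *ᵥ (N *ᵥ a) = a := by rw [mulVec_mulVec, nonsing_inv_mul _ hN, one_mulVec]
  have h31 := dotProduct_mulVec_sub_dotProduct_ge N⁻¹ hS (N *ᵥ a) (W *ᵥ v)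
  rw [hPw] at h31
  linarith [hθ v]

end CrossTerm

end Summit.NavierStokesRegularity.FluidComputer.SkewCutRelaxedEnclosure
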